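import Summits.ResolutionOfSingularities.ResolutionOfSingularities.Theorems.PurelyInseparableDim4E2OfCJSRowsPrime
import Summits.ResolutionOfSingularities.ResolutionOfSingularities.Theorems.PurelyInseparableDim4E2OfCJSModelPrime
import Summits.ResolutionOfSingularities.ResolutionOfSingularities.Theorems.PurelyInseparableDim4E2OfCJSSettingPrime
import Summits.ResolutionOfSingularities.ResolutionOfSingularities.Theorems.PurelyInseparableDim4E2OfCJSLocalizeProof
import HarnessLib

/-!
# The p-PROGRAM of the E2 dictionary: rows (M-b_p) and (M-c_p) as TARGETS BY NAME, (X_p) plugged, and the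
# running assembly «no isolated cone-two chain over K̄ ⟸ CJS Thm 6.40 ∧ (M-b_p) ∧ (I_p)» for every prime p ≥ 3
# (cell `res-dim4-pi`, WORD #66; holder's interface over res-dim4-p-3 g2's `…E2OfCJSRowsPrime`)

[OURS · counted 0 · AI work weaker than expert review.]  Cell `res-dim4-pi` (D-0157 DOOR 2), seat `res-dim4-p-2`
g2 (holder).  NOTHING here proves `LocalizationRowP`, `StrictTransformBlowupP`, `IsolationRowP`, CJS Thm. 6.40,
K2(p) or resolution of singularities in dimension ≥ 4 / characteristic `p`.

* §1 (X_p) PLUGGED: `settingRowP (p) (hp3 : 3 ≤ p) : SettingRowP p` (from `Prime.settingRow_unfolded`, p669826).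
* §2 (M-b_p) `LocalizationRowP p` — p665567's `LocalizationRow` with 3 ↦ p (input = the ∃-block of
  `globalModelP_of_coneTwoChain`, output = the ∃-block of `ModelRowP p`); target of res-dim4-p-7 g2:
  `localizationRowP_of_strictTransformP : StrictTransformBlowupP p → LocalizationRowP p`; glue
  `modelRowP_of_localizationRowP : LocalizationRowP p → ModelRowP p` ((M-a_p) `globalModelP_of_coneTwoChain`).
* §3 (M-c_p) `StrictTransformBlowupP p` — res-dim4-p-7 g2's `StrictTransformBlowup` (p667552) with 3 ↦ p; target
  of res-dim4-p-11 g2: `strictTransformBlowupP : StrictTransformBlowupP p` (his p668759 with `idealOrder_hypSheaf_ξ`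
  already `{p}`).
* §4 the conditional of record: `no_coneTwo_chain_of_CJS_of_localization_isolationP (p) (hp3) (hK640)
  (hMb : LocalizationRowP p) (hI : IsolationRowP p) (K) … : ¬ ∃` isolated cone-two chain over `K = K̄`.

bears_on: LADDER-RESOLUTION:D157-DOOR2 (res-dim4-pi · F4-I(p,p) · CJS dictionary · rows M-b_p/M-c_p/X_p).
Supports stmt-ResolutionOfSingularities-16155 (helper).
-/

set_option linter.dupNamespace false -- mandated namespace of this single-conjunct summit

noncomputable section

open CategoryTheory AlgebraicGeometry TopologicalSpace
open Literature.AlgebraicGeometry.Resolution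
open Literature.AlgebraicGeometry.Resolution.Hauser2010
open Literature.AlgebraicGeometry.Resolution.AffinePointBlowup (P A ξ)
open Literature.AlgebraicGeometry.CossartJannsenSaito2020
open Scheme.IdealSheafData

namespace Summit.ResolutionOfSingularities.ResolutionOfSingularities.Theorems.PIDim4

namespace E2OfCJS

open RidgeBudget (ebar)

/-! ## §1 Row (X_p) plugged -/

/-- **ROW (X_p) `SettingRowP p` HOLDS for every prime `p ≥ 3`** (`Prime.settingRow_unfolded`: excellent,
`dim = 4 ≤ 5`, (F1) `4 + 2 ≤ 2p`, point centre permissible). [OURS · row X_p of the E2 dictionary] [folklore] -/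
theorem settingRowP (p : ℕ) [Fact p.Prime] (hp3 : 3 ≤ p) : SettingRowP p :=
  fun L _ _ _ F hF S _ s hloc hpres hcl => Prime.settingRow_unfolded p hp3 L F hF S s hloc hpres hcl

/-! ## §2 Row (M-b_p): the localisation row at the prime `p`, and (M-a_p) ∧ (M-b_p) ⇒ (M_p) -/

/-- [OURS · row (M-b_p) LOCALISATION · open for p ≠ 3 (res-dim4-p-7 g2)] **A GLOBAL MODEL LOCALISES, at the
prime `p`.**  `LocalizationRow` (p665567) with `3 ↦ p`: over an algebraically closed field of characteristic `p`,
given an isolated `ē ≡ 2` floor chain `c` of the frame at `q = p` and a global model of it (ambients `Z i`, marked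
ideals `M i` of multiplicity `p` reading `(z^p + (c i).F)·𝒪` on open-immersion charts `φ i` at closed points
`x i`, blowing ups `π i` of `x i` with `M (i+1) = (M i).transform (π i) 𝓘_{x i}`, `π i (x (i+1)) = x i` — the
output of `globalModelP_of_coneTwoChain`), the LOCAL data of `ModelRowP p` exist.  NOT proved here.
(Untagged parameterised `Prop`; not asserted.) -/
def LocalizationRowP (p : ℕ) : Prop :=
  ∀ (K : Type) [Field K] [CharP K p] [IsAlgClosed K] [DecidableEq K] (c : ℕ → State K),
    (∀ k, IsIsolated p (c k).F ∧ Step0 p (c k) (c (k + 1)) ∧ ordZero (c k).F = (p : ℕ∞) ∧ ebar (c k).F = 2) →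
    ∀ (Z : ℕ → Scheme.{0}) (_ : ∀ i, IsLocallyNoetherian (Z i)) (_ : ∀ i, JacobsonSpace ↥(Z i))
      (M : ∀ i, MarkedIdeal (Z i)) (x : ∀ i, ↥(Z i)) (hx : ∀ i, IsClosed ({x i} : Set (Z i)))
      (φ : ∀ i, P 4 K ⟶ Z i) (_ : ∀ i, IsOpenImmersion (φ i)) (π : ∀ i, Z (i + 1) ⟶ Z i),
      (∀ i, (M i).mult = p ∧ (φ i) (ξ 4 K) = x i ∧ (M i).ideal.comap (φ i) = hypSheaf p (c i).F ∧
        IsBlowup (π i) (vanishingIdeal ⟨{x i}, hx i⟩) ∧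
        M (i + 1) = (M i).transform (π i) (vanishingIdeal ⟨{x i}, hx i⟩) ∧ (π i) (x (i + 1)) = x i) →
    ∃ (S B : ℕ → Scheme.{0}) (_ : ∀ i, IsLocallyNoetherian (S i)) (_ : ∀ i, IsLocallyNoetherian (B i))
      (π' : ∀ i, B i ⟶ S i) (pt : ∀ i, ↥(S i)) (b : ∀ i, ↥(B i)) (hcl : ∀ i, IsClosed ({pt i} : Set (S i))),
      (∀ i, IsBlowup (π' i) (vanishingIdeal ⟨{pt i}, hcl i⟩)) ∧ (∀ i, (π' i).base (b i) = pt i) ∧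
      (∀ i, IsClosed ({b i} : Set (B i))) ∧ (∀ i, IsLocalSchemeAt (S (i + 1)) (pt (i + 1)) (B i) (b i)) ∧
      (∀ i, IsLocalAt (S i) (pt i)) ∧
      (∀ i, PresentedByP p K (c i).F (S i) (pt i)) ∧ (∀ i, PresentedByP p K (c (i + 1)).F (B i) (b i))

/-- **(M-a_p) ∧ (M-b_p) ⇒ (M_p)**: the global model at the prime `p` (`globalModelP_of_coneTwoChain`, PROVED) and
the localisation row give `ModelRowP p`. [OURS · glue] [folklore] -/
theorem modelRowP_of_localizationRowP (p : ℕ) [Fact p.Prime] (h : LocalizationRowP p) : ModelRowP p := by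
  intro K _ _ _ _ c hc
  obtain ⟨Z, hZ, hJ, M, x, hx, φ, hφ, π, hall⟩ := globalModelP_of_coneTwoChain K p c hc
  exact h K c hc Z hZ hJ M x hx φ hφ π hall

/-- At `p = 3` the p-row IS the landed row. [OURS · adapter] [folklore] -/
theorem localizationRowP_three_iff : LocalizationRowP 3 ↔ LocalizationRow := Iff.rfl

/-! ## §3 Row (M-c_p): «strict transform = blow-up of the hypersurface» at the prime `p` -/

/-- [OURS · row (M-c_p) · open for p ≠ 3 (res-dim4-p-11 g2)] res-dim4-p-7 g2's `StrictTransformBlowup`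
(p667552) with `3 ↦ p`: for a marked ideal `M` of multiplicity `p` on a locally noetherian `Z`, read as
`(z^p + F)·𝒪` (`ordZero F = p`) on an open-immersion chart at the closed point `x`, a blowing up `π : Z' ⟶ Z`
of `x` and `M' = M.transform π 𝓘_x`: `V(M'.ideal) ⟶ Z' ⟶ Z` factors through a morphism
`ρ : V(M'.ideal) ⟶ V(M.ideal)` which is a blowing up of `V(M.ideal)` at its closed point over `x`.  NOT proved
here. (Untagged parameterised `Prop`; not asserted.) -/
def StrictTransformBlowupP (p : ℕ) : Prop :=
  ∀ (K : Type) [Field K] (F : MvPolynomial (Fin 4) K) (Z Z' : Scheme.{0}) [IsLocallyNoetherian Z]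
    [IsLocallyNoetherian Z'] (M : MarkedIdeal Z) (M' : MarkedIdeal Z') (x : Z) (hx : IsClosed ({x} : Set Z))
    (φ : P 4 K ⟶ Z) [IsOpenImmersion φ] (π : Z' ⟶ Z),
    M.mult = p → ordZero F = (p : ℕ∞) → φ (ξ 4 K) = x → M.ideal.comap φ = hypSheaf p F →
    IsBlowup π (vanishingIdeal ⟨{x}, hx⟩) → M' = M.transform π (vanishingIdeal ⟨{x}, hx⟩) →
    ∃ ρ : M'.ideal.subscheme ⟶ M.ideal.subscheme,
      ρ ≫ M.ideal.subschemeι = M'.ideal.subschemeι ≫ π ∧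
      ∀ (y : M.ideal.subscheme) (hy : IsClosed ({y} : Set M.ideal.subscheme)), M.ideal.subschemeι y = x →
        IsBlowup ρ (vanishingIdeal ⟨{y}, hy⟩)

/-- At `p = 3` the p-row IS the landed row. [OURS · adapter] [folklore] -/
theorem strictTransformBlowupP_three_iff : StrictTransformBlowupP 3 ↔ StrictTransformBlowup := Iff.rfl

/-! ## §4 The conditional of record for every prime `p ≥ 3` -/

/-- **NO ISOLATED CONE-TWO CHAIN OVER AN ALGEBRAICALLY CLOSED FIELD OF CHARACTERISTIC `p ≥ 3`, from CJS
Thm. 6.40 and the two open p-rows (M-b_p) and (I_p)** ((N_p), (E_p) by res-dim4-p-3 g2 over p-1/p-5's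
p-generic content, (X_p) by `settingRowP`, (M-a_p) by `globalModelP_of_coneTwoChain`).
[OURS · conditional assembly] [cite: CossartJannsenSaito2020, Thm. 6.40] -/
theorem no_coneTwo_chain_of_CJS_of_localization_isolationP (p : ℕ) [Fact p.Prime] (hp3 : 3 ≤ p)
    (hK640 : KeyTheorem640_char_localized_isolated.{0}) (hMb : LocalizationRowP p) (hI : IsolationRowP p)
    (K : Type) [Field K] [CharP K p] [IsAlgClosed K] [DecidableEq K] :
    ¬ ∃ c : ℕ → State K, ∀ k, IsIsolated p (c k).F ∧ Step0 p (c k) (c (k + 1)) ∧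
      ordZero (c k).F = (p : ℕ∞) ∧ ebar (c k).F = 2 :=
  no_coneTwo_chain_of_CJS_rowsP p hK640 (modelRowP_of_localizationRowP p hMb) hI (settingRowP p hp3) K

/-- The same modulo (M-c_p) instead of (M-b_p), GIVEN res-dim4-p-7 g2's p-version of the localisation
`hloc : StrictTransformBlowupP p → LocalizationRowP p` (stated as a hypothesis until his file lands).
[OURS · conditional assembly] [cite: CossartJannsenSaito2020, Thm. 6.40] -/
theorem no_coneTwo_chain_of_CJS_of_strictTransform_isolationP (p : ℕ) [Fact p.Prime] (hp3 : 3 ≤ p)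
    (hK640 : KeyTheorem640_char_localized_isolated.{0})
    (hloc : StrictTransformBlowupP p → LocalizationRowP p) (hMc : StrictTransformBlowupP p)
    (hI : IsolationRowP p) (K : Type) [Field K] [CharP K p] [IsAlgClosed K] [DecidableEq K] :
    ¬ ∃ c : ℕ → State K, ∀ k, IsIsolated p (c k).F ∧ Step0 p (c k) (c (k + 1)) ∧
      ordZero (c k).F = (p : ℕ∞) ∧ ebar (c k).F = 2 :=
  no_coneTwo_chain_of_CJS_of_localization_isolationP p hp3 hK640 (hloc hMc) hI K

end E2OfCJS

end Summit.ResolutionOfSingularities.ResolutionOfSingularities.Theorems.PIDim4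

end
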